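import Summits.Ventures.QEDPrecision.Diagrams.LeptonLoopGraphs

/-!
HONEST FRAMING: independent recomputation; certified where stated, statistical where stated; no new-physics claim.
Venture QEDPrecision / cell `pub-qed`, unit `pub-qed-diag-2` (DIAG-2, gen 3); NEW WORK of the cell (kernel-checked census), not a
published result.  Model, definitions and counting conventions: `LeptonLoopGraphs.lean` (Python mirror tools/loops_model.py of the
unit folder; staged copies under HOME/lean/diag2/, HOME = run/shared/lean/pub/pub-qed/).

# Order e¹⁰ census of QED vertex graphs with lepton loops — structures with a long lepton path (p ≥ 5)

One kernel computation (`decide`, no `native_decide`, no axioms) per loop structure `(p, lens)`, `p` = number of vertices on the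
open lepton path, `lens` = lengths of the lepton loops: rows (11,[]) 6354 directed / 3213 undirected · (9,[2]) 2072/1049 ·
(7,[4]) 1332/387 · (7,[2,2]) 300/158 · (5,[6]) 960/265 · (5,[4,2]) 408/120 · (5,[2,2,2]) 24/14.  The structures with `p ≤ 3` are in
`LeptonLoopGraphsOrder10Low.lean`; the assembled 19-row table and the totals 12672 / 5536 in `LeptonLoopGraphsOrder10.lean`.
-/

namespace Summit.Ventures.QEDPrecision.Diagrams

set_option maxRecDepth 20000 in
/-- order e¹⁰, structure (p, lens) = (11, []): 6354 directed / 3213 undirected admissible vertex graphs. -/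
theorem order10_row_11_noloops : countRow 5 11 [] = (6354, 3213) := by
  decide +kernel

set_option maxRecDepth 20000 in
/-- order e¹⁰, structure (p, lens) = (9, [2]): 2072 directed / 1049 undirected admissible vertex graphs. -/
theorem order10_row_9_2 : countRow 5 9 [2] = (2072, 1049) := by
  decide +kernel

set_option maxRecDepth 20000 in
/-- order e¹⁰, structure (p, lens) = (7, [4]): 1332 directed / 387 undirected admissible vertex graphs. -/
theorem order10_row_7_4 : countRow 5 7 [4] = (1332, 387) := by
  decide +kernel

set_option maxRecDepth 20000 in
/-- order e¹⁰, structure (p, lens) = (7, [2, 2]): 300 directed / 158 undirected admissible vertex graphs. -/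
theorem order10_row_7_2_2 : countRow 5 7 [2, 2] = (300, 158) := by
  decide +kernel

set_option maxRecDepth 20000 in
/-- order e¹⁰, structure (p, lens) = (5, [6]): 960 directed / 265 undirected admissible vertex graphs. -/
theorem order10_row_5_6 : countRow 5 5 [6] = (960, 265) := by
  decide +kernel

set_option maxRecDepth 20000 in
/-- order e¹⁰, structure (p, lens) = (5, [4, 2]): 408 directed / 120 undirected admissible vertex graphs. -/
theorem order10_row_5_4_2 : countRow 5 5 [4, 2] = (408, 120) := by
  decide +kernel

set_option maxRecDepth 20000 in
/-- order e¹⁰, structure (p, lens) = (5, [2, 2, 2]): 24 directed / 14 undirected admissible vertex graphs. -/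
theorem order10_row_5_2_2_2 : countRow 5 5 [2, 2, 2] = (24, 14) := by
  decide +kernel

end Summit.Ventures.QEDPrecision.Diagrams
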